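import Summits.CriticalPhenomena.PercolationContinuityZ3.Theorems.PercNearOneGluingAdditiveGluingBlockPockets
import HarnessLib

/-! # Crux `PercNearOneGluing.AdditiveGluing` (stmt-CriticalPhenomena-4576), stub `stub_goodStep` — the two LEAVES of the peeling
# certificate (STUB-PLAN Line A: H6 `blockGood_leaf_lemma5`, H7 `blockGood_leaf_ih`)

Stub-plan prover; lands `--supports stmt-CriticalPhenomena-4576`; no definitions, no named facts.  `BG(u, A, S, b, a₀, sel)` is the
block-goodness inequality of the un-glued graph (the kernel `hker` of `goodStep24_main` after `blockGrowth_glue_real_*`):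
`μ(a₀↔b) + μ(a₀↮b, a₀↔S, S↔b) ≤ μ(S↔b) + Σ_{W∩A=∅} μ(K_S = W)·μ(sel W ↔ b in Wᶜ)`, `K_S = ⋃_{s∈S} C(s)`.
* `blockGood_leaf_lemma5` (H6): BG holds as soon as some `v ∈ S` is at least as reliable as `a₀` (`μ(a₀↔b) ≤ μ(v↔b)`, `b ∉ S`) —
  Kozma–Nitzan's Lemma 5 in its gluing form (`stub_gluingLemma5`, seat c1) plus un-gluing (H3); no pocket credit is needed.
* `blockGood_leaf_ih` (H7): BG holds as soon as `a₀` minimises the GLUED two-point function `μ_{u/S}(· ↔ b)` over `A` and the glued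
  quadruple `(u/S, A, s₀, b)` is GOOD for some `s₀ ∈ S` (an induction-hypothesis instance of `stub_goodStep`): the success form of
  goodness (`goodStep24_clean_singleton`) read through un-gluing; the glued pockets of `s₀` are the pockets of the block.
[cite: KozmaNitzan2024, §3.2 (Definition p. 12, Lemma 5 p. 13)]
-/

namespace Summit.CriticalPhenomena.PercolationContinuityZ3.Theorems

open MeasureTheory Set
open Literature.Probability.LatticeModels (prodBernoulli)
open Literature.Probability.Percolation (BondConfig openConn openConnIn openGraph openCluster)
open scoped BigOperators

noncomputable section
open Classical

section BlockGoodLeaves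

open Literature.Probability.LatticeModels Literature.Probability.Percolation

variable {n : ℕ}

/-- **H6 — the Lemma-5 leaf**: if some `v ∈ S` satisfies `μ(a₀ ↔ b) ≤ μ(v ↔ b)` (and `b ∉ S`), then block goodness
`BG(u, A, S, b, a₀, sel)` holds for every selection. [cite: KozmaNitzan2024, §3.2 Lemma 5 (p. 13)] -/
theorem blockGood_leaf_lemma5 (u : Sym2 (Fin n) → unitInterval) (A S : Finset (Fin n)) (b a₀ v : Fin n)
    (sel : Finset (Fin n) → Fin n) (hv : v ∈ S) (hbS : b ∉ S)
    (hle : (prodBernoulli u).real (openConn a₀ b) ≤ (prodBernoulli u).real (openConn v b)) :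
    (prodBernoulli u).real (openConn a₀ b)
        + (prodBernoulli u).real
            ((openConn a₀ b)ᶜ ∩ (⋃ s ∈ S, openConn a₀ s) ∩ (⋃ s ∈ S, openConn s b))
      ≤ (prodBernoulli u).real (⋃ s ∈ S, openConn s b)
        + ∑ W ∈ (Finset.univ : Finset (Finset (Fin n))).filter (fun W => Disjoint W A),
            (prodBernoulli u).real {ω : BondConfig (Fin n) | ∀ z : Fin n, (z ∈ W ↔ ω ∈ ⋃ s ∈ S, openConn s z)}
              * (prodBernoulli u).real (openConnIn ((W : Set (Fin n))ᶜ) (sel W) b) := by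
  have h5 := stub_gluingLemma5 n u S a₀ v b hv hbS hle
  rw [blockGrowth_glue_real_openConn, blockGrowth_glue_real_iUnion] at h5
  exact h5.trans (le_add_of_nonneg_right (Finset.sum_nonneg fun _ _ =>
    mul_nonneg measureReal_nonneg measureReal_nonneg))

/-- The glued pocket of a block vertex is the block pocket: under `u/S` (pushed forward), for `s₀ ∈ S`,
`{ω | ∀ x, x ∈ W ↔ (ω ∪ D_S) ∈ {s₀ ↔ x}} = {K_S = W}`. [cite: KozmaNitzan2024, §3.1 (gluing, Remark p. 5)] -/
theorem glue_preimage_pointPocket (S W : Finset (Fin n)) (s₀ : Fin n) (hs₀ : s₀ ∈ S) :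
    {ω : BondConfig (Fin n) | (ω ∪ {e | (∀ x ∈ e, x ∈ S) ∧ ¬ e.IsDiag}) ∈
        {ω' : BondConfig (Fin n) | ∀ x : Fin n, (x ∈ W ↔ ω' ∈ openConn s₀ x)}} =
      {ω : BondConfig (Fin n) | ∀ z : Fin n, (z ∈ W ↔ ω ∈ ⋃ s ∈ S, openConn s z)} := by
  ext ω
  simp only [Set.mem_setOf_eq]
  refine forall_congr' fun x => iff_congr Iff.rfl ?_
  rw [stub_glueReach n S ω s₀ x]
  simp only [Set.mem_iUnion, exists_prop]
  constructor
  · rintro (h | ⟨-, s, hs, h⟩)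
    · exact ⟨s₀, hs₀, h⟩
    · exact ⟨s, hs, h⟩
  · rintro ⟨s, hs, h⟩
    exact Or.inr ⟨⟨s₀, hs₀, (SimpleGraph.Reachable.refl s₀ : (openGraph ω).Reachable s₀ s₀)⟩, s, hs, h⟩

/-- **H7 — the induction-hypothesis leaf**: if `a₀` minimises the GLUED two-point function `μ_{u/S}(· ↔ b)` over `A ∋ b` and the
glued quadruple `(u/S, A, s₀, b)` is GOOD (selection form, all levels and selections) for some `s₀ ∈ S`, then block goodness
`BG(u, A, S, b, a₀, sel)` holds for every selection `sel W ∈ A`. [cite: KozmaNitzan2024, §3.2 (Definition p. 12)] -/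
theorem blockGood_leaf_ih (u : Sym2 (Fin n) → unitInterval) (A S : Finset (Fin n)) (b a₀ s₀ : Fin n)
    (sel : Finset (Fin n) → Fin n) (hs₀ : s₀ ∈ S) (hbA : b ∈ A)
    (hsel : ∀ W, sel W ∈ A)
    (hmin : ∀ a ∈ A, (prodBernoulli (fun e : Sym2 (Fin n) =>
        if (∀ x ∈ e, x ∈ S) ∧ ¬ e.IsDiag then 1 else u e)).real (openConn a₀ b) ≤
      (prodBernoulli (fun e : Sym2 (Fin n) => if (∀ x ∈ e, x ∈ S) ∧ ¬ e.IsDiag then 1 else u e)).real (openConn a b))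
    (hgood : ∀ (t : ℝ) (sel' : Finset (Fin n) → Fin n), (∀ W, sel' W ∈ A) →
      (∀ a ∈ A, 1 - t ≤ (prodBernoulli (fun e : Sym2 (Fin n) =>
        if (∀ x ∈ e, x ∈ S) ∧ ¬ e.IsDiag then 1 else u e)).real (openConn a b)) →
      (prodBernoulli (fun e : Sym2 (Fin n) => if (∀ x ∈ e, x ∈ S) ∧ ¬ e.IsDiag then 1 else u e)).real
          ((⋃ a ∈ A, openConn s₀ a) ∩ (openConn s₀ b)ᶜ)
        + ∑ W ∈ (Finset.univ : Finset (Finset (Fin n))).filter (fun W => s₀ ∈ W ∧ Disjoint W A),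
            (prodBernoulli (fun e : Sym2 (Fin n) => if (∀ x ∈ e, x ∈ S) ∧ ¬ e.IsDiag then 1 else u e)).real
                {ω : BondConfig (Fin n) | openCluster ω s₀ = (W : Set (Fin n))}
              * (prodBernoulli (fun e : Sym2 (Fin n) => if (∀ x ∈ e, x ∈ S) ∧ ¬ e.IsDiag then 1 else u e)).real
                  (openConnIn ((W : Set (Fin n))ᶜ) (sel' W) b)ᶜ ≤ t) :
    (prodBernoulli u).real (openConn a₀ b)
        + (prodBernoulli u).real
            ((openConn a₀ b)ᶜ ∩ (⋃ s ∈ S, openConn a₀ s) ∩ (⋃ s ∈ S, openConn s b))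
      ≤ (prodBernoulli u).real (⋃ s ∈ S, openConn s b)
        + ∑ W ∈ (Finset.univ : Finset (Finset (Fin n))).filter (fun W => Disjoint W A),
            (prodBernoulli u).real {ω : BondConfig (Fin n) | ∀ z : Fin n, (z ∈ W ↔ ω ∈ ⋃ s ∈ S, openConn s z)}
              * (prodBernoulli u).real (openConnIn ((W : Set (Fin n))ᶜ) (sel W) b) := by
  set g : Sym2 (Fin n) → unitInterval := fun e => if (∀ x ∈ e, x ∈ S) ∧ ¬ e.IsDiag then 1 else u e with hg
  have hG := goodStep24_clean_singleton g A s₀ b a₀ sel hbA hsel hmin hgood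
  rw [goodStep24_glue_singleton g s₀] at hG
  simp only [Finset.set_biUnion_singleton] at hG
  -- left side and the block's reach, un-glued (H3)
  rw [← blockGrowth_glue_real_openConn, ← blockGrowth_glue_real_iUnion u S b]
  have hreach : (prodBernoulli g).real (openConn s₀ b) ≤ (prodBernoulli g).real (⋃ s ∈ S, openConn s b) :=
    measureReal_mono (fun ω hω => Set.mem_iUnion₂.2 ⟨s₀, hs₀, hω⟩) (measure_ne_top _ _)
  -- the pocket terms: glued point pocket of `s₀` = block pocket; the avoiding connection does not see the gluing
  have hterm : ∀ W ∈ (Finset.univ : Finset (Finset (Fin n))).filter (fun W => Disjoint W A),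
      (prodBernoulli g).real {ω : BondConfig (Fin n) | ∀ x : Fin n, (x ∈ W ↔ ω ∈ openConn s₀ x)}
        * (prodBernoulli g).real (openConnIn ((W : Set (Fin n))ᶜ) (sel W) b) ≤
      (prodBernoulli u).real {ω : BondConfig (Fin n) | ∀ z : Fin n, (z ∈ W ↔ ω ∈ ⋃ s ∈ S, openConn s z)}
        * (prodBernoulli u).real (openConnIn ((W : Set (Fin n))ᶜ) (sel W) b) := by
    intro W _
    have e1 : (prodBernoulli g).real {ω : BondConfig (Fin n) | ∀ x : Fin n, (x ∈ W ↔ ω ∈ openConn s₀ x)} =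
        (prodBernoulli u).real {ω : BondConfig (Fin n) | ∀ z : Fin n, (z ∈ W ↔ ω ∈ ⋃ s ∈ S, openConn s z)} := by
      rw [hg, stub_gluePushforward n u S, glue_preimage_pointPocket S W s₀ hs₀]
    by_cases hSW : S ⊆ W
    · have e2 : (prodBernoulli g).real (openConnIn ((W : Set (Fin n))ᶜ) (sel W) b) =
          (prodBernoulli u).real (openConnIn ((W : Set (Fin n))ᶜ) (sel W) b) := by
        refine prodBernoulli_real_eq_of_determinedBy g u (F := ((W : Set (Fin n))ᶜ).sym2) (fun e he => ?_)
          (DCT16.determinedBy_openConnIn _ (sel W) b subset_rfl) MeasurableSet.of_discrete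
        simp only [hg]
        rw [if_neg]
        rintro ⟨hall, hdiag⟩
        induction e using Sym2.ind with
        | h x y =>
          have hx : x ∉ (W : Set (Fin n)) := (Set.mk_mem_sym2_iff.1 he).1
          exact hx (Finset.mem_coe.2 (hSW (hall x (Sym2.mem_mk_left x y))))
      rw [e1, e2]
    · obtain ⟨s₁, hs₁S, hs₁W⟩ := Finset.not_subset.1 hSW
      rw [e1, blockPocket_eq_empty S W s₁ hs₁S hs₁W, measureReal_empty, zero_mul, zero_mul]
  exact hG.trans (add_le_add hreach (Finset.sum_le_sum hterm))

end BlockGoodLeaves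

open Literature.Probability.LatticeModels Literature.Probability.Percolation in
/-- Registered helper stub `stub_blockGoodLeafLemma5_sp` (stub-plan prover; STUB-PLAN Line A, H6): the Lemma-5 leaf of the
peeling certificate — block goodness whenever the block contains a vertex at least as reliable as the designated relay
(= `blockGood_leaf_lemma5`). [cite: KozmaNitzan2024, §3.2 Lemma 5 (p. 13)] -/
theorem stub_blockGoodLeafLemma5_sp : ∀ (n : ℕ) (u : Sym2 (Fin n) → unitInterval) (A S : Finset (Fin n)) (b a₀ v : Fin n) (sel : Finset (Fin n) → Fin n), v ∈ S → b ∉ S → (prodBernoulli u).real (openConn a₀ b) ≤ (prodBernoulli u).real (openConn v b) → (prodBernoulli u).real (openConn a₀ b) + (prodBernoulli u).real ((openConn a₀ b)ᶜ ∩ (⋃ s ∈ S, openConn a₀ s) ∩ (⋃ s ∈ S, openConn s b)) ≤ (prodBernoulli u).real (⋃ s ∈ S, openConn s b) + ∑ W ∈ (Finset.univ : Finset (Finset (Fin n))).filter (fun W => Disjoint W A), (prodBernoulli u).real {ω : BondConfig (Fin n) | ∀ z : Fin n, (z ∈ W ↔ ω ∈ ⋃ s ∈ S, openConn s z)} * (prodBernoulli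 u).real (openConnIn ((W : Set (Fin n))ᶜ) (sel W) b) :=
  fun _ u A S b a₀ v sel hv hbS hle => blockGood_leaf_lemma5 u A S b a₀ v sel hv hbS hle

end

end Summit.CriticalPhenomena.PercolationContinuityZ3.Theorems
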